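import Mathlib.RingTheory.Polynomial.Resultant.Basic
import Mathlib.RingTheory.Polynomial.GaussLemma
import Mathlib.RingTheory.PrincipalIdealDomain
import Mathlib.Analysis.Polynomial.MahlerMeasure
import Mathlib.NumberTheory.MahlerMeasure
import Mathlib.Algebra.Ring.GeomSum
import Mathlib.Data.ZMod.Basic
import Literature.Analysis.Toeplitz.WindingDecay
import HarnessLib

/-!
# Factor detection by short vectors: the resultant lemma behind LLL factoring (LLL 1982, §2)

Support file for the discharge of the named fact
`Literature.Computability.Complexity.lll_monicIrreducible_mem_P` (irreducibility of monic integer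
polynomials is decidable in `P`; Lenstra–Lenstra–Lovász 1982, §3). The algorithm computes, for a
small prime `p`, a monic `u ∈ ℤ[X]` dividing `f` modulo `m = p^k` (Berlekamp + Hensel) and reads
the answer off the first vector of an LLL-reduced basis of the lattice
`L = {g : deg g < n, g ≡ u·(…) (mod m)}`. This file proves the two number-theoretic facts that
make the test correct, in the form of von zur Gathen–Gerhard's simplification of LLL82 §2
(followed by Bremner, §15.7):

* `sqNorm f = Σ fᵢ²`, `rnorm f = (Σ fᵢ²)^{1/2}` — the Euclidean norm `|f|` of LLL82;
* `abs_det_le_prod_col` — Hadamard's inequality for integer matrices (column form), from the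
  tree's `Literature.Analysis.Toeplitz.norm_det_le_prod_norm_col`;
* `abs_resultant_le` — `|Res(f, g)| ≤ |g|^{deg f} |f|^{deg g}` (Hadamard applied to the Sylvester
  matrix; Bremner Lemma 15.37, after von zur Gathen–Gerhard);
* `ModDvd m u f` — "`u` divides `f` modulo `m`", i.e. `f ∈ (u, m) ⊆ ℤ[X]`;
* `resultant_eq_zero_of_modDvd` — **factor detection** (Bremner Lemma 15.38, after von zur
  Gathen–Gerhard §16.5; the rôle of LLL82 Prop. (2.7)): if `u` is monic nonconstant, `u | f` and `u | g` modulo `m`, and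
  `|g|^{deg f} |f|^{deg g} < m`, then `Res(f, g) = 0`;
* `natDegree_le_of_irreducible_of_modDvd` — hence for IRREDUCIBLE monic `f` every nonzero such `g`
  has `deg g ≥ deg f` (the "long first vector" half of the irreducibility test, LLL82 Prop. (2.13)
  specialised to `h₀ = f`);
* `abs_coeff_le_of_dvd`, `sqNorm_le_of_dvd` — **Mignotte's bound** for integer factors,
  `|hᵢ| ≤ C(deg h, i) |f|` and `|h|² ≤ (e+1) 4^e |f|²` for `h | f`, `deg h ≤ e` (Mathlib's Landau
  inequality `mahlerMeasure_le_sqrt_sum_sq_norm_coeff` and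
  `norm_coeff_le_choose_mul_mahlerMeasure_of_one_le_mahlerMeasure`; LLL82 (2.x) cites Mignotte 1974);
* `modDvd_of_modDvd_mul_of_isCoprime` — if `u | g h (mod q^k)` and `ū`, `h̄` are coprime modulo
  `q`, then `u | g (mod q^k)` (inverting `h` modulo `(u, q^k)` by a geometric series): the factor
  `h₀` of `f` whose reduction is divisible by `ū` lies in the lattice `L` (the "short vector
  exists" half, LLL82 (2.5)–(2.6) with Hensel uniqueness replaced by this Bezout argument).

## Mathlib / tree search

Mathlib: `Polynomial.resultant` (= `det (sylvester f g m n)`), `exists_mul_add_mul_eq_C_resultant`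
(Bezout with degree bounds), `resultant_eq_zero_iff` (fields), `resultant_map_map`; Mahler measure
and Landau/Mignotte as above; no Hadamard inequality, no `ℓ²` norm of integer polynomials (TODO in
`Mathlib.Analysis.Polynomial.Norm`). Tree: Hadamard `Literature.Analysis.InnerProduct.norm_det_le_prod_norm`,
`Literature.Analysis.Toeplitz.norm_det_le_prod_norm_col` (used here); the LLL algorithm and
Prop. (1.11) live in `Literature/Algebra/EuclideanLattices/LLL*.lean`, `PQCLLL*.lean`.

## References

* A. K. Lenstra, H. W. Lenstra Jr., L. Lovász, *Factoring polynomials with rational coefficients*,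
  Math. Ann. 261 (1982) 515–534, §2 (Props. (2.5)–(2.7), (2.13)), §3. [LenstraLenstraLovasz1982]
  (not held; doi:10.1007/bf01457454 requested)
* J. von zur Gathen, J. Gerhard, *Modern Computer Algebra*, 3rd ed., CUP 2013, §§16.4–16.5
  (Zassenhaus and LLL factoring; Bremner: "Our exposition follows von zur Gathen and Gerhard,
  §§16.4–16.5"). [GathenGerhard2013] (not held; followed through the held secondary source below)
* M. R. Bremner, *Lattice Basis Reduction*, CRC Press 2011, §15.6–15.7: Lemma 15.30, Lemma 15.35
  (Mignotte), Lemma 15.36 (Bezout for the resultant), Lemma 15.37, Lemma 15.38 (factor detection).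
  [Bremner2011] (held: book:bremnernd-lattice-basis-reduction, PDF pp. 240–245)
* M. Mignotte, *An inequality about factors of polynomials*, Math. Comp. 28 (1974) 1153–1157.
-/

noncomputable section

open Polynomial Finset

namespace Literature.Computability.Complexity

namespace LLLFactoring

/-! ### The Euclidean norm of an integer polynomial -/

/-- `|f|² = Σᵢ fᵢ²`, the squared Euclidean norm of the coefficient vector (LLL82: "`|Σ aᵢXⁱ| =
(Σ aᵢ²)^{1/2}`"). [cite: LenstraLenstraLovasz1982, §1 (notation before (1.6)) and §2] -/
def sqNorm (f : ℤ[X]) : ℤ := ∑ i ∈ f.support, f.coeff i ^ 2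

/-- `|f| = (Σᵢ fᵢ²)^{1/2}` as a real number. [cite: LenstraLenstraLovasz1982, §2] -/
def rnorm (f : ℤ[X]) : ℝ := Real.sqrt (sqNorm f)

/-- `|f|² ≥ 0`. [folklore] -/
theorem sqNorm_nonneg (f : ℤ[X]) : 0 ≤ sqNorm f := sum_nonneg fun _ _ => sq_nonneg _

/-- `|f| ≥ 0`. [folklore] -/
theorem rnorm_nonneg (f : ℤ[X]) : 0 ≤ rnorm f := Real.sqrt_nonneg _

/-- `|f|²` cast to `ℝ` is the square of `|f|`. [folklore] -/
theorem rnorm_sq (f : ℤ[X]) : rnorm f ^ 2 = (sqNorm f : ℝ) :=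
  Real.sq_sqrt (by exact_mod_cast sqNorm_nonneg f)

/-- `|f|²` as a sum over any initial segment of indices containing the support. [folklore] -/
theorem sqNorm_eq_sum_range {f : ℤ[X]} {N : ℕ} (h : f.natDegree < N) :
    sqNorm f = ∑ i ∈ range N, f.coeff i ^ 2 := by
  unfold sqNorm
  refine Finset.sum_subset (fun i hi => mem_range.2 ((le_natDegree_of_mem_supp i hi).trans_lt h))
    fun i _ hi => ?_
  rw [notMem_support_iff.1 hi]
  ring

/-- A single coefficient is bounded by the norm: `fᵢ² ≤ |f|²`. [folklore] -/
theorem sq_coeff_le_sqNorm (f : ℤ[X]) (i : ℕ) : f.coeff i ^ 2 ≤ sqNorm f := by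
  by_cases hi : i ∈ f.support
  · exact Finset.single_le_sum (f := fun j => f.coeff j ^ 2) (fun _ _ => sq_nonneg _) hi
  · rw [notMem_support_iff.1 hi]
    simpa using sqNorm_nonneg f

/-- `|f|² = 0 ↔ f = 0`. [folklore] -/
theorem sqNorm_eq_zero_iff (f : ℤ[X]) : sqNorm f = 0 ↔ f = 0 := by
  constructor
  · intro h
    ext i
    have := sq_coeff_le_sqNorm f i
    rw [h] at this
    have h0 : f.coeff i ^ 2 = 0 := le_antisymm this (sq_nonneg _)
    simpa using h0
  · rintro rfl
    simp [sqNorm]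

/-- A monic polynomial has `|f|² ≥ 1`. [folklore] -/
theorem one_le_sqNorm_of_monic {f : ℤ[X]} (hf : f.Monic) : 1 ≤ sqNorm f := by
  have := sq_coeff_le_sqNorm f f.natDegree
  rw [Polynomial.Monic.coeff_natDegree hf] at this
  simpa using this

/-- A monic polynomial has `|f| ≥ 1`. [folklore] -/
theorem one_le_rnorm_of_monic {f : ℤ[X]} (hf : f.Monic) : 1 ≤ rnorm f := by
  rw [rnorm, Real.one_le_sqrt]
  exact_mod_cast one_le_sqNorm_of_monic hf

/-- `|f| = 0 ↔ f = 0`. [folklore] -/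
theorem rnorm_eq_zero_iff (f : ℤ[X]) : rnorm f = 0 ↔ f = 0 := by
  rw [rnorm, Real.sqrt_eq_zero (by exact_mod_cast sqNorm_nonneg f), ← sqNorm_eq_zero_iff]
  exact_mod_cast Iff.rfl

/-! ### Hadamard's inequality for integer matrices and the resultant bound -/

/-- **Hadamard's inequality**, integer matrices, column form: `|det M| ≤ ∏ₖ (Σⱼ M_{jk}²)^{1/2}`
(from the tree's complex version `norm_det_le_prod_norm_col`). [cite: Bremner2011, Lemma 15.30 (proof: "Apply Hadamard's inequality to the Sylvester matrix")] -/
theorem abs_det_le_prod_col {N : ℕ} (M : Matrix (Fin N) (Fin N) ℤ) :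
    (|M.det| : ℝ) ≤ ∏ k, Real.sqrt (∑ j, (M j k : ℝ) ^ 2) := by
  have h := Literature.Analysis.Toeplitz.norm_det_le_prod_norm_col ((Int.castRingHom ℂ).mapMatrix M)
  rw [← RingHom.map_det, Int.coe_castRingHom, Complex.norm_intCast] at h
  refine h.trans (le_of_eq (Finset.prod_congr rfl fun k _ => ?_))
  congr 1
  refine Finset.sum_congr rfl fun j _ => ?_
  rw [RingHom.mapMatrix_apply, Matrix.map_apply, Int.coe_castRingHom, Complex.norm_intCast, sq_abs]

/-- A window sum: `Σ_{i<N} [j ≤ i ≤ j+n] c(i-j) = Σ_{t ≤ n} c(t)` when the window fits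
(`j + n < N`). [folklore] -/
theorem sum_window (c : ℕ → ℝ) (j n N : ℕ) (h : j + n < N) :
    (∑ i ∈ range N, if j ≤ i ∧ i ≤ j + n then c (i - j) else 0) = ∑ t ∈ range (n + 1), c t := by
  rw [← Finset.sum_filter]
  have hset : (range N).filter (fun i => j ≤ i ∧ i ≤ j + n) = (range (n + 1)).image (· + j) := by
    ext i
    simp only [mem_filter, mem_range, mem_image]
    constructor
    · intro hi
      exact ⟨i - j, by omega, by omega⟩
    · rintro ⟨t, ht, rfl⟩
      omega
  rw [hset, Finset.sum_image fun a _ b _ hab => by simpa using hab]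
  exact Finset.sum_congr rfl fun t _ => by rw [Nat.add_sub_cancel]

/-- The squared norm of a polynomial as a window sum of its coefficients over `0, …, n`
(`deg g ≤ n`). [folklore] -/
theorem sum_range_sq_coeff_eq {g : ℤ[X]} {n : ℕ} (hg : g.natDegree ≤ n) :
    (∑ t ∈ range (n + 1), (g.coeff t : ℝ) ^ 2) = (sqNorm g : ℝ) := by
  rw [sqNorm_eq_sum_range (Nat.lt_succ_of_le hg)]
  push_cast
  rfl

/-- **Hadamard's bound for the resultant**: `|Res_{m,n}(f, g)| ≤ |g|^m |f|^n` for `deg f ≤ m`,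
`deg g ≤ n` (the Sylvester matrix has `m` columns of coefficients of `g` and `n` columns of
coefficients of `f`). [cite: Bremner2011, Lemma 15.37] -/
theorem abs_resultant_le (f g : ℤ[X]) {m n : ℕ} (hf : f.natDegree ≤ m) (hg : g.natDegree ≤ n) :
    ((|resultant f g m n| : ℤ) : ℝ) ≤ rnorm g ^ m * rnorm f ^ n := by
  have h := abs_det_le_prod_col (sylvester f g m n)
  rw [Int.cast_abs]
  rw [resultant]
  refine h.trans (le_of_eq ?_)
  rw [Fin.prod_univ_add]
  congr 1
  · -- the `m` columns of `g`
    rw [show rnorm g ^ m = ∏ _k : Fin m, rnorm g by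
      rw [Finset.prod_const, Finset.card_univ, Fintype.card_fin]]
    refine Finset.prod_congr rfl fun k _ => ?_
    rw [rnorm]
    congr 1
    have hcol : ∀ j : Fin (m + n), ((sylvester f g m n j (Fin.castAdd n k) : ℤ) : ℝ) ^ 2 =
        if (k : ℕ) ≤ j ∧ (j : ℕ) ≤ k + n then (g.coeff (j - k) : ℝ) ^ 2 else 0 := by
      intro j
      rw [sylvester, Matrix.of_apply, Fin.addCases_left]
      simp only [Set.mem_Icc]
      split_ifs <;> simp
    simp_rw [hcol]
    rw [Fin.sum_univ_eq_sum_range (fun j => if (k : ℕ) ≤ j ∧ j ≤ k + n then (g.coeff (j - k) : ℝ) ^ 2 else 0),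
      sum_window (fun t => (g.coeff t : ℝ) ^ 2) k n (m + n) (by omega), sum_range_sq_coeff_eq hg]
  · -- the `n` columns of `f`
    rw [show rnorm f ^ n = ∏ _k : Fin n, rnorm f by
      rw [Finset.prod_const, Finset.card_univ, Fintype.card_fin]]
    refine Finset.prod_congr rfl fun k _ => ?_
    rw [rnorm]
    congr 1
    have hcol : ∀ j : Fin (m + n), ((sylvester f g m n j (Fin.natAdd m k) : ℤ) : ℝ) ^ 2 =
        if (k : ℕ) ≤ j ∧ (j : ℕ) ≤ k + m then (f.coeff (j - k) : ℝ) ^ 2 else 0 := by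
      intro j
      rw [sylvester, Matrix.of_apply, Fin.addCases_right]
      simp only [Set.mem_Icc]
      split_ifs <;> simp
    simp_rw [hcol]
    rw [Fin.sum_univ_eq_sum_range (fun j => if (k : ℕ) ≤ j ∧ j ≤ k + m then (f.coeff (j - k) : ℝ) ^ 2 else 0),
      sum_window (fun t => (f.coeff t : ℝ) ^ 2) k m (m + n) (by omega), sum_range_sq_coeff_eq hf]

/-! ### Divisibility modulo `m` and the factor-detection lemma -/

/-- **`ModDvd m u f`: `u` divides `f` modulo `m`**, i.e. `f ≡ u·v (mod m ℤ[X])` for some `v`,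
i.e. `f` lies in the ideal `(u, m)` of `ℤ[X]`. With `u = h` (the `p`-adic factor to precision
`m = p^k`) this is the condition "`(h mod p^k)` divides `(f mod p^k)`" of LLL82 (2.1)–(2.3); the
lattice `L` of LLL82 (2.3) is `{g : deg g ≤ m', ModDvd p^k h g}`. [cite: LenstraLenstraLovasz1982, (2.3)] -/
def ModDvd (m : ℕ) (u f : ℤ[X]) : Prop := f ∈ Ideal.span ({u, C (m : ℤ)} : Set ℤ[X])

/-- `ModDvd m u f ↔ f = u v + m w` for some `v, w`. [folklore] -/
theorem modDvd_iff {m : ℕ} {u f : ℤ[X]} : ModDvd m u f ↔ ∃ v w : ℤ[X], f = u * v + C (m : ℤ) * w := by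
  rw [ModDvd, Ideal.mem_span_pair]
  constructor
  · rintro ⟨a, b, h⟩
    exact ⟨a, b, by rw [← h]; ring⟩
  · rintro ⟨v, w, h⟩
    exact ⟨v, w, by rw [h]; ring⟩

/-- `ModDvd m u` is closed under sums. [folklore] -/
theorem ModDvd.add {m : ℕ} {u f g : ℤ[X]} (hf : ModDvd m u f) (hg : ModDvd m u g) : ModDvd m u (f + g) :=
  Ideal.add_mem _ hf hg

/-- `ModDvd m u` is closed under multiples. [folklore] -/
theorem ModDvd.mul_left {m : ℕ} {u f : ℤ[X]} (hf : ModDvd m u f) (a : ℤ[X]) : ModDvd m u (a * f) :=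
  Ideal.mul_mem_left _ a hf

/-- `ModDvd m u` is closed under integer linear combinations. [folklore] -/
theorem ModDvd.sum_smul {m : ℕ} {u : ℤ[X]} {ι : Type*} (s : Finset ι) (c : ι → ℤ) (g : ι → ℤ[X])
    (h : ∀ i ∈ s, ModDvd m u (g i)) : ModDvd m u (∑ i ∈ s, c i • g i) :=
  Submodule.sum_mem _ fun i hi => by
    rw [zsmul_eq_mul]
    exact (h i hi).mul_left _

/-- `u` divides its own multiples modulo `m`. [folklore] -/
theorem ModDvd.of_dvd {m : ℕ} {u f : ℤ[X]} (h : u ∣ f) : ModDvd m u f := by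
  obtain ⟨v, rfl⟩ := h
  exact modDvd_iff.2 ⟨v, 0, by ring⟩

/-- Multiples of `m` are divisible by anything modulo `m`. [folklore] -/
theorem ModDvd.of_modulus_dvd {m : ℕ} {u f : ℤ[X]} (h : C (m : ℤ) ∣ f) : ModDvd m u f := by
  obtain ⟨w, rfl⟩ := h
  exact modDvd_iff.2 ⟨0, w, by ring⟩

/-- `ModDvd` passes to a divisor of the modulus. [folklore] -/
theorem ModDvd.of_modulus_dvd_modulus {m m' : ℕ} {u f : ℤ[X]} (hm : m' ∣ m) (h : ModDvd m u f) :
    ModDvd m' u f := by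
  obtain ⟨v, w, rfl⟩ := modDvd_iff.1 h
  obtain ⟨c, rfl⟩ := hm
  exact modDvd_iff.2 ⟨v, C (c : ℤ) * w, by rw [Nat.cast_mul, C_mul]; ring⟩

/-- Reduction of `ModDvd m u f` modulo `m`: `f̄ = ū · v̄` in `(ℤ/m)[X]`. [folklore] -/
theorem ModDvd.exists_map_eq {m : ℕ} {u f : ℤ[X]} (h : ModDvd m u f) :
    ∃ v : ℤ[X], f.map (Int.castRingHom (ZMod m)) = u.map (Int.castRingHom (ZMod m)) * v.map (Int.castRingHom (ZMod m)) := by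
  obtain ⟨v, w, rfl⟩ := modDvd_iff.1 h
  refine ⟨v, ?_⟩
  rw [Polynomial.map_add, Polynomial.map_mul, Polynomial.map_mul, Polynomial.map_C]
  simp

/-- If `u` is monic of positive degree and `u` divides the integer constant `r` modulo `m`, then
`m | r`. [folklore] -/
theorem dvd_of_modDvd_C {m : ℕ} (hm : 2 ≤ m) {u : ℤ[X]} (hu : u.Monic) (hu0 : 0 < u.natDegree)
    {r : ℤ} (h : ModDvd m u (C r)) : (m : ℤ) ∣ r := by
  haveI : Fact (1 < m) := ⟨hm⟩
  obtain ⟨v, hv⟩ := h.exists_map_eq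
  rw [Polynomial.map_C] at hv
  set φ := Int.castRingHom (ZMod m)
  by_cases hA : v.map φ = 0
  · rw [hA, mul_zero, ← map_zero C, C_inj] at hv
    exact (ZMod.intCast_zmod_eq_zero_iff_dvd r m).1 hv
  · exfalso
    have hdeg := congrArg natDegree hv
    rw [natDegree_C, (hu.map φ).natDegree_mul' hA, hu.natDegree_map] at hdeg
    omega

/-- **Factor detection (Bremner Lemma 15.38, after von zur Gathen–Gerhard §16.5; the rôle of LLL82
Prop. (2.7)).**
Let `u ∈ ℤ[X]` be monic of positive degree and `m ≥ 2`. If `u` divides both `f` and `g` modulo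
`m`, `deg f > 0`, and `|g|^{deg f} |f|^{deg g} < m`, then `Res(f, g) = 0` (so `f` and `g` have a
nonconstant common factor over `ℚ`). Proof: Bezout `sf + tg = Res(f,g)` makes `u` divide the
constant `Res(f, g)` modulo `m`, whence `m | Res(f, g)`; but `|Res(f, g)| < m` by Hadamard.
[cite: Bremner2011, Lemma 15.38] [cite: GathenGerhard2013, §16.5] [cite: LenstraLenstraLovasz1982, Prop. (2.7)] -/
theorem resultant_eq_zero_of_modDvd {m : ℕ} (hm : 2 ≤ m) {u f g : ℤ[X]} (hu : u.Monic)
    (hu0 : 0 < u.natDegree) (hf0 : 0 < f.natDegree) (hfu : ModDvd m u f) (hgu : ModDvd m u g)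
    (hlt : rnorm g ^ f.natDegree * rnorm f ^ g.natDegree < m) : resultant f g = 0 := by
  obtain ⟨P, Q, -, -, hPQ⟩ :=
    exists_mul_add_mul_eq_C_resultant f g le_rfl le_rfl (Or.inl hf0.ne')
  -- `u` divides the constant `Res(f, g)` modulo `m`
  have hR : ModDvd m u (C (resultant f g)) := by
    rw [← hPQ, mul_comm f, mul_comm g]
    exact (hfu.mul_left P).add (hgu.mul_left Q)
  have hdvd : (m : ℤ) ∣ resultant f g := dvd_of_modDvd_C hm hu hu0 hR
  -- and is smaller than `m` in absolute value
  have habs : |resultant f g| < (m : ℤ) := by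
    have h := (abs_resultant_le f g le_rfl le_rfl).trans_lt hlt
    exact_mod_cast h
  exact Int.eq_zero_of_abs_lt_dvd hdvd habs

/-- **The "long vector" half of the irreducibility test.** If `f ∈ ℤ[X]` is monic irreducible,
`u` monic nonconstant divides `f` modulo `m ≥ 2`, and `g ≠ 0` is divisible by `u` modulo `m` with
`|g|^{deg f} |f|^{deg g} < m`, then `deg g ≥ deg f`: the lattice `{g : deg g < deg f, u | g mod m}`
has no short nonzero vector. (LLL82 Prop. (2.13) with `h₀ = f`; von zur Gathen–Gerhard §16.5.)
[cite: LenstraLenstraLovasz1982, Prop. (2.13)] [cite: Bremner2011, §15.7] -/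
theorem natDegree_le_of_irreducible_of_modDvd {m : ℕ} (hm : 2 ≤ m) {u f g : ℤ[X]}
    (hf : f.Monic) (hirr : Irreducible f) (hu : u.Monic) (hu0 : 0 < u.natDegree)
    (hfu : ModDvd m u f) (hgu : ModDvd m u g) (hg0 : g ≠ 0)
    (hlt : rnorm g ^ f.natDegree * rnorm f ^ g.natDegree < m) : f.natDegree ≤ g.natDegree := by
  have hf0 : 0 < f.natDegree := by
    by_contra h0
    have h1 : f = 1 := eq_one_of_monic_natDegree_zero hf (Nat.le_zero.1 (not_lt.1 h0))
    exact hirr.not_isUnit (h1 ▸ isUnit_one)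
  have hR := resultant_eq_zero_of_modDvd hm hu hu0 hf0 hfu hgu hlt
  -- pass to `ℚ[X]`
  set φ := algebraMap ℤ ℚ with hφ
  have hφi : Function.Injective φ := by
    rw [hφ]; exact Int.cast_injective
  have hRq : resultant (f.map φ) (g.map φ) = 0 := by
    have := resultant_map_map f g f.natDegree g.natDegree φ
    rw [hR, map_zero] at this
    rwa [resultant, natDegree_map_eq_of_injective hφi, natDegree_map_eq_of_injective hφi]
  have hirrq : Irreducible (f.map φ) := (hf.irreducible_iff_irreducible_map_fraction_map).1 hirr
  have hgq0 : g.map φ ≠ 0 := fun h => hg0 ((Polynomial.map_eq_zero_iff hφi).1 h)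
  obtain ⟨-, hnc⟩ := resultant_eq_zero_iff.1 hRq
  have hdvd : f.map φ ∣ g.map φ := by
    by_contra hnd
    exact hnc ((hirrq.coprime_iff_not_dvd).2 hnd)
  have := natDegree_le_of_dvd hdvd hgq0
  rwa [natDegree_map_eq_of_injective hφi, natDegree_map_eq_of_injective hφi] at this

/-! ### Mignotte's bound for integer factors -/

/-- **Mignotte's bound, coefficient form**: if `h | f` in `ℤ[X]` and `f ≠ 0` then
`|hᵢ| ≤ C(deg h, i) |f|` (Landau: `M(f) ≤ |f|`; `M(h) ≤ M(f)` as the cofactor has Mahler measure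
`≥ 1`; `|hᵢ| ≤ C(deg h, i) M(h)`). [cite: Bremner2011, Lemma 15.35] [cite: LenstraLenstraLovasz1982, §2 (use of Mignotte 1974)] -/
theorem abs_coeff_le_of_dvd {h f : ℤ[X]} (hf : f ≠ 0) (hd : h ∣ f) (i : ℕ) :
    (|h.coeff i| : ℝ) ≤ (h.natDegree.choose i : ℝ) * rnorm f := by
  obtain ⟨q, rfl⟩ := hd
  have hq : q ≠ 0 := right_ne_zero_of_mul hf
  set ι := Int.castRingHom ℂ with hι
  have hιi : Function.Injective ι := Int.cast_injective
  have h1 : 1 ≤ (q.map ι).mahlerMeasure := one_le_mahlerMeasure_of_ne_zero hq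
  have hc := norm_coeff_le_choose_mul_mahlerMeasure_of_one_le_mahlerMeasure i (h.map ι) (q.map ι) h1
  rw [coeff_map, hι, Int.coe_castRingHom, Complex.norm_intCast, natDegree_map_eq_of_injective hιi,
    ← Polynomial.map_mul] at hc
  refine hc.trans (mul_le_mul_of_nonneg_left ?_ (Nat.cast_nonneg _))
  -- Landau's inequality `M(f) ≤ |f|`
  have hL := mahlerMeasure_le_sqrt_sum_sq_norm_coeff ((h * q).map (Int.castRingHom ℂ))
  refine hL.trans (le_of_eq ?_)
  rw [rnorm, support_map_of_injective _ hιi]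
  congr 1
  rw [sqNorm]
  push_cast
  refine Finset.sum_congr rfl fun j _ => ?_
  rw [coeff_map, Int.coe_castRingHom, Complex.norm_intCast, sq_abs]

/-- **Mignotte's bound, norm form**: if `h | f` in `ℤ[X]`, `f ≠ 0` and `deg h ≤ e`, then
`|h|² ≤ (e+1)·4^e·|f|²` (from the coefficient form and `C(e, i) ≤ 2^e`). [cite: Bremner2011, Lemma 15.35] -/
theorem sqNorm_le_of_dvd {h f : ℤ[X]} (hf : f ≠ 0) (hd : h ∣ f) {e : ℕ} (he : h.natDegree ≤ e) :
    sqNorm h ≤ (e + 1) * 4 ^ e * sqNorm f := by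
  -- each coefficient: `hᵢ² ≤ 4^e |f|²`
  have hcoef : ∀ i, (h.coeff i : ℝ) ^ 2 ≤ (4 : ℝ) ^ e * sqNorm f := by
    intro i
    have h1 := abs_coeff_le_of_dvd hf hd i
    have h2 : (h.natDegree.choose i : ℝ) ≤ 2 ^ e := by
      have : h.natDegree.choose i ≤ 2 ^ e :=
        (Nat.choose_le_two_pow _ _).trans (Nat.pow_le_pow_right (by norm_num) he)
      exact_mod_cast this
    have h3 : (|h.coeff i| : ℝ) ≤ 2 ^ e * rnorm f :=
      h1.trans (mul_le_mul_of_nonneg_right h2 (rnorm_nonneg f))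
    have h4 := pow_le_pow_left₀ (abs_nonneg _) h3 2
    rw [sq_abs, mul_pow, rnorm_sq, ← pow_mul, show (2 : ℝ) ^ (e * 2) = 4 ^ e by
      rw [mul_comm, pow_mul]; norm_num] at h4
    exact h4
  have hsum : (sqNorm h : ℝ) ≤ (e + 1) * 4 ^ e * sqNorm f := by
    rw [sqNorm_eq_sum_range (Nat.lt_succ_of_le he)]
    push_cast
    calc (∑ i ∈ range (e + 1), (h.coeff i : ℝ) ^ 2) ≤ ∑ _i ∈ range (e + 1), (4 : ℝ) ^ e * sqNorm f :=
          Finset.sum_le_sum fun i _ => hcoef i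
      _ = (e + 1) * 4 ^ e * sqNorm f := by rw [Finset.sum_const, Finset.card_range, nsmul_eq_mul]; push_cast; ring
  exact_mod_cast hsum

/-! ### Lifting divisibility through a coprime cofactor -/

/-- **Inverting a coprime cofactor modulo `(u, q^k)`.** If `u` divides `g·h` modulo `q^k` and the
reductions of `u` and `h` modulo `q` are coprime in `(ℤ/q)[X]`, then `u` divides `g` modulo
`q^k`. (Bezout `s u + t h = 1 + q r` in `ℤ[X]`; multiply by the geometric series
`Σ_{i<k} (-q r)^i` to invert `1 + q r` modulo `q^k`.) This puts the factor `h₀` of `f` whose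
reduction `ū` divides into the lattice `L` of LLL82 (2.3), the content of LLL82 (2.5)–(2.6).
[cite: LenstraLenstraLovasz1982, Prop. (2.5)–(2.6)] -/
theorem modDvd_of_modDvd_mul_of_isCoprime {q k : ℕ} {u g h : ℤ[X]}
    (hgh : ModDvd (q ^ k) u (g * h))
    (hcop : IsCoprime (u.map (Int.castRingHom (ZMod q))) (h.map (Int.castRingHom (ZMod q)))) :
    ModDvd (q ^ k) u g := by
  set φ := Int.castRingHom (ZMod q) with hφ
  have hφs : Function.Surjective φ := ZMod.intCast_surjective
  obtain ⟨sbar, tbar, hst⟩ := hcop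
  obtain ⟨s, rfl⟩ := Polynomial.map_surjective φ hφs sbar
  obtain ⟨t, rfl⟩ := Polynomial.map_surjective φ hφs tbar
  -- `s u + t h = 1 + q r`
  have hker : (s * u + t * h - 1).map φ = 0 := by
    rw [Polynomial.map_sub, Polynomial.map_add, Polynomial.map_mul, Polynomial.map_mul, hst,
      Polynomial.map_one, sub_self]
  have hdvdC : C (q : ℤ) ∣ s * u + t * h - 1 := by
    rw [C_dvd_iff_dvd_coeff]
    intro i
    have hi := congrArg (fun p => p.coeff i) hker
    simp only [coeff_map, coeff_zero, hφ, Int.coe_castRingHom] at hi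
    exact (ZMod.intCast_zmod_eq_zero_iff_dvd _ q).1 hi
  obtain ⟨r, hr⟩ := hdvdC
  -- geometric series: `N (1 - x) = 1 - x^k` with `x = -q r`
  set x : ℤ[X] := -(C (q : ℤ) * r) with hx
  set N : ℤ[X] := ∑ i ∈ range k, x ^ i with hN
  have hgeom : N * (1 - x) = 1 - x ^ k := geom_sum_mul_neg x k
  have h1x : 1 - x = s * u + t * h := by
    rw [hx, sub_neg_eq_add]
    linear_combination (-1 : ℤ[X]) * hr
  -- `x^k` is a multiple of `q^k`
  have hxk : C ((q ^ k : ℕ) : ℤ) ∣ x ^ k := by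
    refine ⟨(-r) ^ k, ?_⟩
    rw [hx, show -(C (q : ℤ) * r) = C (q : ℤ) * (-r) by ring, mul_pow, ← C_pow]
    push_cast
    ring
  -- `g = N t (g h) + N s u g + x^k g`
  have hdecomp : g = N * t * (g * h) + N * s * g * u + x ^ k * g := by
    have : g = (N * (1 - x) + x ^ k) * g := by rw [hgeom]; ring
    rw [h1x] at this
    linear_combination this
  rw [hdecomp]
  refine ((hgh.mul_left (N * t)).add ?_).add ?_
  · exact ModDvd.of_dvd ⟨N * s * g, by ring⟩
  · exact ModDvd.of_modulus_dvd (dvd_mul_of_dvd_left hxk g)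

end LLLFactoring

end Literature.Computability.Complexity
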